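import Summits.NavierStokesRegularity.NavierStokesRegularity.Theorems.TypeITraceScarL3.Negative.StubCSpreadWitness
import HarnessLib

/-!
# The kinematic SPREAD witness for Stub C of crux `TypeITraceScarL3` (stmt-NavierStokesRegularity-18385),
# part 2: the Type-I quantity `𝐈 ≤ M` on the whole lower half-space (clause (I))

Negative-lane lemma file of the disprover seat `cdisprove-stmt-NavierStokesRegularity-18385` (`--supports` the
item); continues `StubCSpreadWitness`.  The scale-invariant quantities of Albritton–Barker are translation
invariant and subadditive up to constants: the tree's slice bounds for the bump (`sliceA_le`, `sliceC_le`,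
`sliceE_le`) are re-proved for an arbitrary centre, added, and integrated over cylinders — `A ≤ 32|B₁|`,
`C ≤ 64|B₁|`, `E ≤ 3072 L²|B₁|` (`L = sup|χ′|`), `D = 0` (pressure `0`) on EVERY parabolic cylinder in `t < 0`,
hence `𝐈(Q(a)) ≤ M` for all `a` with one `M` (`typeIBound_spread_cylinder_le`).  WHAT THIS IS NOT: not a
Navier–Stokes solution; not NS regularity.  References: D. Albritton, T. Barker, Arch. Ration. Mech. Anal. 232
(2019), §1, (1.5)–(1.8) [AlbrittonBarker2019].
-/

noncomputable section

set_option linter.dupNamespace false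

namespace Summit.NavierStokesRegularity.NavierStokesRegularity.Theorems.TypeITraceScarL3.Negative

open MeasureTheory Set Function Filter Topology Metric TopologicalSpace
open Literature.Analysis.FluidPDE Literature.Analysis.FluidPDE.ParabolicBump
open scoped NNReal ENNReal InnerProductSpace RealInnerProductSpace

/-- Scaled slice energy of a field dominated by `(−t)⁻¹ 𝟙_{B(x_c, 2√(−t))}`: `≤ 8|B₁|`
(the tree's `sliceA_le` with an arbitrary centre). [folklore] -/
theorem sliceA_le_of_indicator {v : EuclideanSpace ℝ (Fin 3) → EuclideanSpace ℝ (Fin 3)}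
    {xc : EuclideanSpace ℝ (Fin 3)} {t r : ℝ} (ht : t < 0) (hr : 0 < r)
    (x₀ : EuclideanSpace ℝ (Fin 3))
    (hv : ∀ x, ‖v x‖ₑ ^ 2 ≤
      (ball xc (2 * Real.sqrt (-t))).indicator (fun _ => ENNReal.ofReal (1 / (-t))) x) :
    (ENNReal.ofReal r)⁻¹ * ∫⁻ x in ball x₀ r, ‖v x‖ₑ ^ 2 ≤
      8 * volume (ball (0 : EuclideanSpace ℝ (Fin 3)) 1) := by
  set V₁ := volume (ball (0 : EuclideanSpace ℝ (Fin 3)) 1) with hV₁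
  have hs : 0 < Real.sqrt (-t) := Real.sqrt_pos.2 (by linarith)
  have hnt : 0 < -t := by linarith
  have ht0 : t ≠ 0 := ht.ne
  have hs0 : Real.sqrt (-t) ≠ 0 := hs.ne'
  have hI : ∫⁻ x in ball x₀ r, ‖v x‖ₑ ^ 2 ≤
      ENNReal.ofReal (1 / (-t)) * volume (ball xc (2 * Real.sqrt (-t)) ∩ ball x₀ r) := by
    calc ∫⁻ x in ball x₀ r, ‖v x‖ₑ ^ 2
        ≤ ∫⁻ x in ball x₀ r, (ball xc (2 * Real.sqrt (-t))).indicator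
            (fun _ => ENNReal.ofReal (1 / (-t))) x := lintegral_mono fun x => hv x
      _ = _ := lintegral_ball_indicator_const x₀ r measurableSet_ball _
  have h8 : ENNReal.ofReal 8 = 8 := by norm_num
  by_cases hcase : r ^ 2 ≤ -t
  · calc (ENNReal.ofReal r)⁻¹ * ∫⁻ x in ball x₀ r, ‖v x‖ₑ ^ 2
        ≤ (ENNReal.ofReal r)⁻¹ * (ENNReal.ofReal (1 / (-t)) * volume (ball x₀ r)) :=
          mul_le_mul' le_rfl (hI.trans (mul_le_mul' le_rfl (measure_mono inter_subset_right)))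
      _ = ENNReal.ofReal (r⁻¹ * (1 / (-t)) * r ^ 3) * V₁ := by
          rw [volume_ball_three x₀ hr, ← ENNReal.ofReal_inv_of_pos hr, ← mul_assoc, ← mul_assoc,
            ← ENNReal.ofReal_mul (by positivity), ← ENNReal.ofReal_mul (by positivity)]
      _ ≤ ENNReal.ofReal 8 * V₁ := by
          refine mul_le_mul' (ENNReal.ofReal_le_ofReal ?_) le_rfl
          have e : r⁻¹ * (1 / (-t)) * r ^ 3 = r ^ 2 / (-t) := by
            field_simp
          rw [e]
          have := (div_le_one hnt).2 hcase
          linarith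
      _ = 8 * V₁ := by rw [h8]
  · push Not at hcase
    have hsr : Real.sqrt (-t) < r := (Real.sqrt_lt' hr).2 hcase
    calc (ENNReal.ofReal r)⁻¹ * ∫⁻ x in ball x₀ r, ‖v x‖ₑ ^ 2
        ≤ (ENNReal.ofReal r)⁻¹ *
            (ENNReal.ofReal (1 / (-t)) * volume (ball xc (2 * Real.sqrt (-t)))) :=
          mul_le_mul' le_rfl (hI.trans (mul_le_mul' le_rfl (measure_mono inter_subset_left)))
      _ = ENNReal.ofReal (r⁻¹ * (1 / (-t)) * (2 * Real.sqrt (-t)) ^ 3) * V₁ := by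
          rw [volume_ball_three xc (by positivity), ← ENNReal.ofReal_inv_of_pos hr, ← mul_assoc,
            ← mul_assoc, ← ENNReal.ofReal_mul (by positivity), ← ENNReal.ofReal_mul (by positivity)]
      _ ≤ ENNReal.ofReal 8 * V₁ := by
          refine mul_le_mul' (ENNReal.ofReal_le_ofReal ?_) le_rfl
          rw [two_sqrt_cube ht]
          have e : r⁻¹ * (1 / (-t)) * (8 * (-t) * Real.sqrt (-t)) = 8 * (Real.sqrt (-t) / r) := by
            field_simp
          rw [e]
          have : Real.sqrt (-t) / r ≤ 1 := (div_le_one hr).2 hsr.le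
          linarith
      _ = 8 * V₁ := by rw [h8]

/-- Slice bound for the cubic quantity of a field dominated by `(−t)^{−3/2} 𝟙_{B(x_c, 2√(−t))}`:
`≤ 8|B₁|` (the tree's `sliceC_le` with an arbitrary centre). [folklore] -/
theorem sliceC_le_of_indicator {v : EuclideanSpace ℝ (Fin 3) → EuclideanSpace ℝ (Fin 3)}
    {xc : EuclideanSpace ℝ (Fin 3)} {t : ℝ} (ht : t < 0) (x₀ : EuclideanSpace ℝ (Fin 3)) (r : ℝ)
    (hv : ∀ x, ‖v x‖ₑ ^ (3 : ℕ) ≤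
      (ball xc (2 * Real.sqrt (-t))).indicator
        (fun _ => ENNReal.ofReal ((1 / Real.sqrt (-t)) ^ 3)) x) :
    ∫⁻ x in ball x₀ r, ‖v x‖ₑ ^ (3 : ℕ) ≤ 8 * volume (ball (0 : EuclideanSpace ℝ (Fin 3)) 1) := by
  set V₁ := volume (ball (0 : EuclideanSpace ℝ (Fin 3)) 1) with hV₁
  have hs : 0 < Real.sqrt (-t) := Real.sqrt_pos.2 (by linarith)
  calc ∫⁻ x in ball x₀ r, ‖v x‖ₑ ^ (3 : ℕ)
      ≤ ∫⁻ x in ball x₀ r, (ball xc (2 * Real.sqrt (-t))).indicator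
          (fun _ => ENNReal.ofReal ((1 / Real.sqrt (-t)) ^ 3)) x := lintegral_mono fun x => hv x
    _ = ENNReal.ofReal ((1 / Real.sqrt (-t)) ^ 3) *
          volume (ball xc (2 * Real.sqrt (-t)) ∩ ball x₀ r) :=
        lintegral_ball_indicator_const x₀ r measurableSet_ball _
    _ ≤ ENNReal.ofReal ((1 / Real.sqrt (-t)) ^ 3) * volume (ball xc (2 * Real.sqrt (-t))) :=
        mul_le_mul' le_rfl (measure_mono inter_subset_left)
    _ = ENNReal.ofReal ((1 / Real.sqrt (-t)) ^ 3 * (2 * Real.sqrt (-t)) ^ 3) * V₁ := by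
        rw [volume_ball_three xc (by positivity), ← mul_assoc, ← ENNReal.ofReal_mul (by positivity)]
    _ = 8 * V₁ := by
        rw [← mul_pow, show 1 / Real.sqrt (-t) * (2 * Real.sqrt (-t)) = 2 by field_simp]
        norm_num

/-- Slice dissipation of a gradient dominated by `48L²/(−t)² 𝟙_{B(x_c, 2√(−t))}`:
`≤ 384 L² (−t)^{−1/2} |B₁|` (the tree's `sliceE_le` with an arbitrary centre). [folklore] -/
theorem sliceE_le_of_indicator
    {Gs : EuclideanSpace ℝ (Fin 3) → EuclideanSpace ℝ (Fin 3) →L[ℝ] EuclideanSpace ℝ (Fin 3)}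
    {xc : EuclideanSpace ℝ (Fin 3)} {L t : ℝ} (ht : t < 0) (x₀ : EuclideanSpace ℝ (Fin 3)) (r : ℝ)
    (hG : ∀ x, ENNReal.ofReal (frobeniusNormSq (Gs x)) ≤
      (ball xc (2 * Real.sqrt (-t))).indicator
        (fun _ => ENNReal.ofReal (48 * L ^ 2 / (-t) ^ 2)) x) :
    ∫⁻ x in ball x₀ r, ENNReal.ofReal (frobeniusNormSq (Gs x)) ≤
      ENNReal.ofReal (384 * L ^ 2 * (0 - t) ^ (-(1 / 2) : ℝ)) *
        volume (ball (0 : EuclideanSpace ℝ (Fin 3)) 1) := by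
  set V₁ := volume (ball (0 : EuclideanSpace ℝ (Fin 3)) 1) with hV₁
  have hs : 0 < Real.sqrt (-t) := Real.sqrt_pos.2 (by linarith)
  calc ∫⁻ x in ball x₀ r, ENNReal.ofReal (frobeniusNormSq (Gs x))
      ≤ ∫⁻ x in ball x₀ r, (ball xc (2 * Real.sqrt (-t))).indicator
          (fun _ => ENNReal.ofReal (48 * L ^ 2 / (-t) ^ 2)) x := lintegral_mono fun x => hG x
    _ = ENNReal.ofReal (48 * L ^ 2 / (-t) ^ 2) *
          volume (ball xc (2 * Real.sqrt (-t)) ∩ ball x₀ r) :=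
        lintegral_ball_indicator_const x₀ r measurableSet_ball _
    _ ≤ ENNReal.ofReal (48 * L ^ 2 / (-t) ^ 2) * volume (ball xc (2 * Real.sqrt (-t))) :=
        mul_le_mul' le_rfl (measure_mono inter_subset_left)
    _ = ENNReal.ofReal (48 * L ^ 2 / (-t) ^ 2 * (2 * Real.sqrt (-t)) ^ 3) * V₁ := by
        rw [volume_ball_three xc (by positivity), ← mul_assoc, ← ENNReal.ofReal_mul (by positivity)]
    _ = ENNReal.ofReal (384 * L ^ 2 * (0 - t) ^ (-(1 / 2) : ℝ)) * V₁ := by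
        rw [real_E_identity ht L]

/-- `r⁻¹ ∫_{B(x₀,r)} |U(t)|² ≤ 32|B₁|`. [folklore] -/
theorem sliceA_spread_le {t r : ℝ} (ht : t < 0) (hr : 0 < r) (x₀ : EuclideanSpace ℝ (Fin 3)) :
    (ENNReal.ofReal r)⁻¹ * ∫⁻ x in ball x₀ r, ‖spreadVelocity t x‖ₑ ^ 2 ≤
      32 * volume (ball (0 : EuclideanSpace ℝ (Fin 3)) 1) := by
  set V₁ := volume (ball (0 : EuclideanSpace ℝ (Fin 3)) 1) with hV₁
  have hV := sliceA_le ht hr x₀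
  have hW := sliceA_le_of_indicator (v := travelVelocity t) ht hr x₀ (enorm_sq_travel_le ht)
  have h1 : ∫⁻ x in ball x₀ r, ‖spreadVelocity t x‖ₑ ^ 2 ≤
      (2 * ∫⁻ x in ball x₀ r, ‖apexVelocity t x‖ₑ ^ 2) + 2 * ∫⁻ x in ball x₀ r, ‖travelVelocity t x‖ₑ ^ 2 := by
    calc ∫⁻ x in ball x₀ r, ‖spreadVelocity t x‖ₑ ^ 2
        ≤ ∫⁻ x in ball x₀ r, (2 * ‖apexVelocity t x‖ₑ ^ 2 + 2 * ‖travelVelocity t x‖ₑ ^ 2) :=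
          lintegral_mono fun x => enorm_add_sq_le _ _
      _ = _ := by
          rw [lintegral_add_left ((measurable_enorm_apex_sq t).const_mul _),
            lintegral_const_mul _ (measurable_enorm_apex_sq t),
            lintegral_const_mul'' _ ((continuous_travelVelocity t).measurable.enorm.pow_const _).aemeasurable]
  calc (ENNReal.ofReal r)⁻¹ * ∫⁻ x in ball x₀ r, ‖spreadVelocity t x‖ₑ ^ 2
      ≤ (ENNReal.ofReal r)⁻¹ * ((2 * ∫⁻ x in ball x₀ r, ‖apexVelocity t x‖ₑ ^ 2) +
          2 * ∫⁻ x in ball x₀ r, ‖travelVelocity t x‖ₑ ^ 2) := mul_le_mul' le_rfl h1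
    _ = 2 * ((ENNReal.ofReal r)⁻¹ * ∫⁻ x in ball x₀ r, ‖apexVelocity t x‖ₑ ^ 2) +
          2 * ((ENNReal.ofReal r)⁻¹ * ∫⁻ x in ball x₀ r, ‖travelVelocity t x‖ₑ ^ 2) := by ring
    _ ≤ 2 * (8 * V₁) + 2 * (8 * V₁) := add_le_add (mul_le_mul' le_rfl hV) (mul_le_mul' le_rfl hW)
    _ = 32 * V₁ := by ring

/-- `∫_{B(x₀,r)} |U(t)|³ ≤ 64|B₁|`. [folklore] -/
theorem sliceC_spread_le {t : ℝ} (ht : t < 0) (x₀ : EuclideanSpace ℝ (Fin 3)) (r : ℝ) :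
    ∫⁻ x in ball x₀ r, ‖spreadVelocity t x‖ₑ ^ (3 : ℕ) ≤
      64 * volume (ball (0 : EuclideanSpace ℝ (Fin 3)) 1) := by
  set V₁ := volume (ball (0 : EuclideanSpace ℝ (Fin 3)) 1) with hV₁
  have hV := sliceC_le ht x₀ r
  have hW := sliceC_le_of_indicator (v := travelVelocity t) ht x₀ r (enorm_cube_travel_le ht)
  calc ∫⁻ x in ball x₀ r, ‖spreadVelocity t x‖ₑ ^ (3 : ℕ)
      ≤ ∫⁻ x in ball x₀ r, (4 * ‖apexVelocity t x‖ₑ ^ (3 : ℕ) + 4 * ‖travelVelocity t x‖ₑ ^ (3 : ℕ)) :=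
        lintegral_mono fun x => enorm_add_cube_le _ _
    _ = (4 * ∫⁻ x in ball x₀ r, ‖apexVelocity t x‖ₑ ^ (3 : ℕ)) +
          4 * ∫⁻ x in ball x₀ r, ‖travelVelocity t x‖ₑ ^ (3 : ℕ) := by
        rw [lintegral_add_left ((measurable_enorm_apex_cube t).const_mul _),
          lintegral_const_mul _ (measurable_enorm_apex_cube t),
          lintegral_const_mul'' _ ((continuous_travelVelocity t).measurable.enorm.pow_const _).aemeasurable]
    _ ≤ 4 * (8 * V₁) + 4 * (8 * V₁) := add_le_add (mul_le_mul' le_rfl hV) (mul_le_mul' le_rfl hW)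
    _ = 64 * V₁ := by ring

/-- `∫_{B(x₀,r)} |∇U(t)|²_F ≤ 4 · 384 L² (−t)^{−1/2} |B₁|`. [folklore] -/
theorem sliceE_spread_le {L : ℝ} (hL0 : 0 ≤ L) (hL : ∀ s, |deriv cutoff s| ≤ L) {t : ℝ} (ht : t < 0)
    (x₀ : EuclideanSpace ℝ (Fin 3)) (r : ℝ) :
    ∫⁻ x in ball x₀ r, ENNReal.ofReal (frobeniusNormSq (spreadGradient t x)) ≤
      4 * (ENNReal.ofReal (384 * L ^ 2 * (0 - t) ^ (-(1 / 2) : ℝ)) *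
        volume (ball (0 : EuclideanSpace ℝ (Fin 3)) 1)) := by
  have hV := sliceE_le hL0 hL ht x₀ r
  have hW := sliceE_le_of_indicator (Gs := travelGradient t) ht x₀ r (frob_travelGradient_le hL0 hL ht)
  have hmeasW : AEMeasurable (fun x => ENNReal.ofReal (frobeniusNormSq (travelGradient t x)))
      (volume.restrict (ball x₀ r)) := by
    have hc : Continuous fun x : EuclideanSpace ℝ (Fin 3) => travelGradient t x :=
      (continuous_apexGradient t).comp (continuous_id.sub continuous_const)
    exact (ENNReal.continuous_ofReal.comp (continuous_frobeniusNormSq₃.comp hc)).measurable.aemeasurable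
  calc ∫⁻ x in ball x₀ r, ENNReal.ofReal (frobeniusNormSq (spreadGradient t x))
      ≤ ∫⁻ x in ball x₀ r, (2 * ENNReal.ofReal (frobeniusNormSq (apexGradient t x)) +
          2 * ENNReal.ofReal (frobeniusNormSq (travelGradient t x))) :=
        lintegral_mono fun x => ofReal_frobeniusNormSq_add_le _ _
    _ = (2 * ∫⁻ x in ball x₀ r, ENNReal.ofReal (frobeniusNormSq (apexGradient t x))) +
          2 * ∫⁻ x in ball x₀ r, ENNReal.ofReal (frobeniusNormSq (travelGradient t x)) := by
        rw [lintegral_add_left ((measurable_frob_apexGradient t).const_mul _),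
          lintegral_const_mul _ (measurable_frob_apexGradient t), lintegral_const_mul'' _ hmeasW]
    _ ≤ 2 * (ENNReal.ofReal (384 * L ^ 2 * (0 - t) ^ (-(1 / 2) : ℝ)) *
          volume (ball (0 : EuclideanSpace ℝ (Fin 3)) 1)) +
        2 * (ENNReal.ofReal (384 * L ^ 2 * (0 - t) ^ (-(1 / 2) : ℝ)) *
          volume (ball (0 : EuclideanSpace ℝ (Fin 3)) 1)) :=
        add_le_add (mul_le_mul' le_rfl hV) (mul_le_mul' le_rfl hW)
    _ = _ := by ring

/-! ### The Type-I quantity of the witness on the open lower half-space -/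

/-- The witness is a.e.-measurable on the slab. [folklore] -/
theorem aemeasurable_spreadVelocity_slab :
    AEMeasurable (uncurry spreadVelocity)
      (volume.restrict (Iio (0 : ℝ) ×ˢ (univ : Set (EuclideanSpace ℝ (Fin 3))))) :=
  (contDiffOn_spreadVelocity (n := 0)).continuousOn.aemeasurable (measurableSet_Iio.prod MeasurableSet.univ)

/-- The gradient integrand is a.e.-measurable on the slab. [folklore] -/
theorem aemeasurable_frob_spreadGradient_slab :
    AEMeasurable (fun q : ℝ × EuclideanSpace ℝ (Fin 3) =>
        ENNReal.ofReal (frobeniusNormSq (spreadGradient q.1 q.2)))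
      (volume.restrict (Iio (0 : ℝ) ×ˢ (univ : Set (EuclideanSpace ℝ (Fin 3))))) := by
  have hc : ContinuousOn (fun q : ℝ × EuclideanSpace ℝ (Fin 3) => fderiv ℝ (spreadVelocity q.1) q.2)
      (Iio (0 : ℝ) ×ˢ univ) :=
    continuousOn_fderiv_slice_of_contDiffOn (contDiffOn_spreadVelocity (n := 1)) isOpen_Iio.uniqueDiffOn
  have hc2 : ContinuousOn (fun q : ℝ × EuclideanSpace ℝ (Fin 3) =>
      ENNReal.ofReal (frobeniusNormSq (spreadGradient q.1 q.2))) (Iio (0 : ℝ) ×ˢ univ) := by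
    have e : (fun q : ℝ × EuclideanSpace ℝ (Fin 3) =>
        ENNReal.ofReal (frobeniusNormSq (spreadGradient q.1 q.2))) =
        fun q => ENNReal.ofReal (frobeniusNormSq (fderiv ℝ (spreadVelocity q.1) q.2)) := by
      funext q; rw [fderiv_spreadVelocity]
    rw [e]
    exact ENNReal.continuous_ofReal.comp_continuousOn (continuous_frobeniusNormSq₃.comp_continuousOn hc)
  exact hc2.aemeasurable (measurableSet_Iio.prod MeasurableSet.univ)

/-- `A(Q(z,r)) ≤ 32|B₁|` for every admissible cylinder. [folklore] -/
theorem cknAEss_spread_le {r : ℝ} (hr : 0 < r) {z : ℝ × EuclideanSpace ℝ (Fin 3)}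
    (hz : parabolicCylinder r z ⊆ Iio (0 : ℝ) ×ˢ (univ : Set (EuclideanSpace ℝ (Fin 3)))) :
    cknAEss r z spreadVelocity ≤ 32 * volume (ball (0 : EuclideanSpace ℝ (Fin 3)) 1) := by
  unfold cknAEss
  refine essSup_le_of_ae_le _ ?_
  filter_upwards [ae_restrict_mem measurableSet_Ioo] with t ht
  exact sliceA_spread_le (neg_of_mem_time hr hz ht) hr z.2

/-- `C(Q(z,r)) ≤ 64|B₁|` for every admissible cylinder. [folklore] -/
theorem cknC_spread_le {r : ℝ} (hr : 0 < r) {z : ℝ × EuclideanSpace ℝ (Fin 3)}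
    (hz : parabolicCylinder r z ⊆ Iio (0 : ℝ) ×ˢ (univ : Set (EuclideanSpace ℝ (Fin 3)))) :
    cknC r z spreadVelocity ≤ 64 * volume (ball (0 : EuclideanSpace ℝ (Fin 3)) 1) := by
  set V₁ := volume (ball (0 : EuclideanSpace ℝ (Fin 3)) 1) with hV₁
  unfold cknC
  have hmeas : AEMeasurable (fun q : ℝ × EuclideanSpace ℝ (Fin 3) => ‖spreadVelocity q.1 q.2‖ₑ ^ (3 : ℕ))
      (volume.restrict (parabolicCylinder r z)) :=
    ((aemeasurable_spreadVelocity_slab.mono_measure (Measure.restrict_mono hz le_rfl)).enorm.pow_const _)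
  have h1 : ∫⁻ q in parabolicCylinder r z, ‖spreadVelocity q.1 q.2‖ₑ ^ (3 : ℕ) ≤
      ∫⁻ _ in Ioo (z.1 - r ^ 2) z.1, 64 * V₁ :=
    lintegral_cylinder_le_of_slice hmeas (by
      filter_upwards [ae_restrict_mem measurableSet_Ioo] with t ht
      exact sliceC_spread_le (neg_of_mem_time hr hz ht) z.2 r)
  rw [setLIntegral_const, Real.volume_Ioo, show z.1 - (z.1 - r ^ 2) = r ^ 2 by ring,
    ENNReal.ofReal_pow hr.le] at h1
  have hX0 : ENNReal.ofReal r ^ 2 ≠ 0 := pow_ne_zero _ (ENNReal.ofReal_pos.2 hr).ne'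
  have hXt : ENNReal.ofReal r ^ 2 ≠ ⊤ := ENNReal.pow_ne_top ENNReal.ofReal_ne_top
  calc (ENNReal.ofReal r ^ 2)⁻¹ * ∫⁻ q in parabolicCylinder r z, ‖spreadVelocity q.1 q.2‖ₑ ^ (3 : ℕ)
      ≤ (ENNReal.ofReal r ^ 2)⁻¹ * (64 * V₁ * ENNReal.ofReal r ^ 2) := mul_le_mul' le_rfl h1
    _ = 64 * V₁ := by
        rw [mul_comm (64 * V₁) _, ← mul_assoc, ENNReal.inv_mul_cancel hX0 hXt, one_mul]

/-- `E(Q(z,r)) ≤ 3072 L² |B₁|` for every admissible cylinder. [folklore] -/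
theorem cknE_spread_le {L : ℝ} (hL0 : 0 ≤ L) (hL : ∀ s, |deriv cutoff s| ≤ L) {r : ℝ} (hr : 0 < r)
    {z : ℝ × EuclideanSpace ℝ (Fin 3)}
    (hz : parabolicCylinder r z ⊆ Iio (0 : ℝ) ×ˢ (univ : Set (EuclideanSpace ℝ (Fin 3)))) :
    cknE r z spreadGradient ≤
      ENNReal.ofReal (3072 * L ^ 2) * volume (ball (0 : EuclideanSpace ℝ (Fin 3)) 1) := by
  set V₁ := volume (ball (0 : EuclideanSpace ℝ (Fin 3)) 1) with hV₁
  have hz1 : z.1 ≤ 0 := fst_nonpos_of_subset hr hz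
  unfold cknE
  have hmeas : AEMeasurable (fun q : ℝ × EuclideanSpace ℝ (Fin 3) =>
      ENNReal.ofReal (frobeniusNormSq (spreadGradient q.1 q.2)))
      (volume.restrict (parabolicCylinder r z)) :=
    aemeasurable_frob_spreadGradient_slab.mono_measure (Measure.restrict_mono hz le_rfl)
  have h1 : ∫⁻ q in parabolicCylinder r z, ENNReal.ofReal (frobeniusNormSq (spreadGradient q.1 q.2)) ≤
      ∫⁻ t in Ioo (z.1 - r ^ 2) z.1,
        ENNReal.ofReal (1536 * L ^ 2) * V₁ * ENNReal.ofReal ((0 - t) ^ (-(1 / 2) : ℝ)) :=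
    lintegral_cylinder_le_of_slice hmeas (by
      filter_upwards [ae_restrict_mem measurableSet_Ioo] with t ht
      have ht0 : t < 0 := neg_of_mem_time hr hz ht
      refine (sliceE_spread_le hL0 hL ht0 z.2 r).trans (le_of_eq ?_)
      rw [ENNReal.ofReal_mul (by positivity : (0 : ℝ) ≤ 384 * L ^ 2),
        show (1536 : ℝ) * L ^ 2 = 4 * (384 * L ^ 2) by ring,
        ENNReal.ofReal_mul (by norm_num : (0 : ℝ) ≤ 4), ENNReal.ofReal_ofNat]
      ring)
  have h2 : ∫⁻ t in Ioo (z.1 - r ^ 2) z.1,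
        ENNReal.ofReal (1536 * L ^ 2) * V₁ * ENNReal.ofReal ((0 - t) ^ (-(1 / 2) : ℝ)) ≤
      ENNReal.ofReal (1536 * L ^ 2) * V₁ * ENNReal.ofReal (2 * r) := by
    rw [lintegral_const_mul' _ _ (ENNReal.mul_ne_top ENNReal.ofReal_ne_top measure_ball_lt_top.ne)]
    exact mul_le_mul' le_rfl (lintegral_invSqrt_time_le hz1 hr)
  calc (ENNReal.ofReal r)⁻¹ *
        ∫⁻ q in parabolicCylinder r z, ENNReal.ofReal (frobeniusNormSq (spreadGradient q.1 q.2))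
      ≤ (ENNReal.ofReal r)⁻¹ * (ENNReal.ofReal (1536 * L ^ 2) * V₁ * ENNReal.ofReal (2 * r)) :=
        mul_le_mul' le_rfl (h1.trans h2)
    _ = ENNReal.ofReal (3072 * L ^ 2) * V₁ := by
        rw [← ENNReal.ofReal_inv_of_pos hr]
        have e1 : ENNReal.ofReal r⁻¹ * (ENNReal.ofReal (1536 * L ^ 2) * V₁ * ENNReal.ofReal (2 * r)) =
            (ENNReal.ofReal r⁻¹ * ENNReal.ofReal (1536 * L ^ 2) * ENNReal.ofReal (2 * r)) * V₁ := by
          ring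
        have e2 : ENNReal.ofReal r⁻¹ * ENNReal.ofReal (1536 * L ^ 2) * ENNReal.ofReal (2 * r) =
            ENNReal.ofReal (r⁻¹ * (1536 * L ^ 2) * (2 * r)) := by
          rw [ENNReal.ofReal_mul (by positivity : (0 : ℝ) ≤ r⁻¹ * (1536 * L ^ 2)),
            ENNReal.ofReal_mul (by positivity : (0 : ℝ) ≤ r⁻¹)]
        have e3 : r⁻¹ * (1536 * L ^ 2) * (2 * r) = 3072 * L ^ 2 := by
          field_simp
          ring
        rw [e1, e2, e3]

/-- **`𝐈(ℝ³ × ℝ₋) ≤ M < ⊤` for the witness** (pressure `0`). [folklore] -/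
theorem typeIBound_spread_le :
    ∃ M : ℝ≥0, typeIBound (Iio (0 : ℝ) ×ˢ (univ : Set (EuclideanSpace ℝ (Fin 3))))
      spreadVelocity 0 spreadGradient ≤ M := by
  obtain ⟨L, hL0, hL⟩ := exists_bound_deriv_cutoff
  set V₁ := volume (ball (0 : EuclideanSpace ℝ (Fin 3)) 1) with hV₁
  have hV : V₁ < ⊤ := measure_ball_lt_top
  set B : ℝ≥0∞ := 32 * V₁ + 64 * V₁ + 0 + ENNReal.ofReal (3072 * L ^ 2) * V₁ with hB
  have hbound : typeIBound (Iio (0 : ℝ) ×ˢ (univ : Set (EuclideanSpace ℝ (Fin 3))))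
      spreadVelocity 0 spreadGradient ≤ B := by
    refine typeIBound_le_iff.2 fun r hr z hz => ?_
    unfold abScaledSum
    exact add_le_add (add_le_add (add_le_add (cknAEss_spread_le hr hz) (cknC_spread_le hr hz))
      (cknDOsc_zero r z).le) (cknE_spread_le hL0 hL hr hz)
  have hBtop : B ≠ ⊤ := by
    have h32 : (32 : ℝ≥0∞) * V₁ < ⊤ := ENNReal.mul_lt_top (by simp) hV
    have h64 : (64 : ℝ≥0∞) * V₁ < ⊤ := ENNReal.mul_lt_top (by simp) hV
    exact (ENNReal.add_lt_top.2 ⟨ENNReal.add_lt_top.2 ⟨ENNReal.add_lt_top.2 ⟨h32, h64⟩, by simp⟩,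
      ENNReal.mul_lt_top ENNReal.ofReal_lt_top hV⟩).ne
  refine ⟨B.toNNReal, ?_⟩
  rw [ENNReal.coe_toNNReal hBtop]
  exact hbound

/-- Hence `𝐈(Q(a)) ≤ M` for every cylinder at the origin (one `M` for all `a`). [folklore] -/
theorem typeIBound_spread_cylinder_le :
    ∃ M : ℝ≥0, ∀ a : ℝ, typeIBound (parabolicCylinder a (0 : ℝ × EuclideanSpace ℝ (Fin 3)))
      spreadVelocity 0 spreadGradient ≤ M := by
  obtain ⟨M, hM⟩ := typeIBound_spread_le
  exact ⟨M, fun a => (typeIBound_mono (parabolicCylinder_subset_slab a)).trans hM⟩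

end Summit.NavierStokesRegularity.NavierStokesRegularity.Theorems.TypeITraceScarL3.Negative

end
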